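import Mathlib

/-!
# [OURS · L1 W4.5(b) · EL♮(3) `stmt-ResolutionOfSingularities-20148`] crux idea `toric-towers` — ROUND 16 «KEY-POLYNOMIAL LETTERS»: Sketch

res-L1-w45b-idea-1 g25 (crux-ideate IDEATOR 1; technique = characteristic-free combinatorial / toric). Counted 0 · AI-written, weaker than
expert review · nothing of [Hironaka2017] is asserted · resolution in positive characteristic / EL♮(3) is NOT proved here · no `sorry`,
no instance, no notation, standard axioms. NOT a statement of the route; a SKETCH supporting the crux idea card
`Cruxes/EquisingularLiftNatThree/Ideas/toric-towers.md` §ROUND 16.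

CONTENT.
* `exists_lift_support_eq` — the toric heart of the card in its most naive form: along ANY surjection `π : O →+* k` a polynomial lifts
  VERBATIM with the SAME SUPPORT (hence the same Newton polyhedron, the same initial-form shapes for every weight, the same order along
  every coordinate subspace). Only COEFFICIENT phenomena (a binomial coefficient divisible by `p`, an inseparable initial form) fail to lift;
  SHAPES always lift. A key-polynomial LETTER `V(g)` (below) is used only through such shape data and through ring identities that hold over
  every commutative ring, i.e. simultaneously over `O` and over `k`.
* `keyLetter_chart3`, `duValLetter_chart3`, `S10_chart3` — the composite chart `P:S.y · CAR:E1.x · PHI:Ephi.z` of res-L1-w45b-lead-1's S10 atlas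
  (`L/res-L1-w45b-lead-1/m7/atlas7.sage`, memo RESIDUE-CUSTOMER-S10.md) is the MONOMIAL map `(X, Y, Z) = (x²yz², xyz, xyz²)` (unimodular exponent
  matrix `[[2,1,2],[1,1,1],[0,0,... ]]` — see the card); the identities certify, over every commutative ring at once (so for the verbatim `O`-lift and
  its special fibre by the same computation): the third strict transform of the key letter `W_q = V(X² + Y²Z)` is `V(x + y)`, that of the du Val
  key letter `M = V(X² + Y²Z + Z³)` is `V(x + y + yz²)`, and the third strict transform of S10 is `(x + y)² + z²·R` — so the `k_q = 0` death curve
  `σ∗ = {z = 0, x + y = 0} = E_φ ∩ St³W_q = E_φ ∩ St³M` of R41″ is a MEMBER CROSSING once a key letter is admitted (kit j315305 / j315415 confirm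
  the whole 5-move schedule chart by chart at nine primes).
-/

set_option linter.dupNamespace false

namespace Summit.ResolutionOfSingularities.ResolutionOfSingularities.Cruxes.EquisingularLiftNatThree.ToricTowers.R16

open MvPolynomial

/-- **Verbatim lift with equal support.** Along a surjective ring map, every polynomial is the image of one with literally the same
support (choose any preimage coefficientwise). Consequence used by the card: Newton polyhedra, initial-form SHAPES and weighted orders of a
letter / of the hypersurface equation are the same upstairs (over `O`) and downstairs (over `k`). [OURS · elementary] -/
theorem exists_lift_support_eq {σ O k : Type*} [CommSemiring O] [CommSemiring k] (π : O →+* k)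
    (hπ : Function.Surjective π) (g : MvPolynomial σ k) :
    ∃ g' : MvPolynomial σ O, MvPolynomial.map π g' = g ∧ g'.support = g.support := by
  classical
  choose l hl using hπ
  refine ⟨∑ m ∈ g.support, monomial m (l (g.coeff m)), ?_, ?_⟩
  · rw [map_sum]
    simp_rw [map_monomial, hl]
    exact g.as_sum.symm
  · ext m
    rw [mem_support_iff, coeff_sum]
    simp_rw [coeff_monomial]
    rw [Finset.sum_ite_eq' g.support m]
    by_cases hm : m ∈ g.support
    · simp only [hm, if_true, ne_eq, iff_true]
      intro h0
      apply (mem_support_iff.mp hm)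
      rw [← hl (g.coeff m), h0, map_zero]
    · simp [hm]

/-- The weighted order is a SHAPE datum: with equal supports, membership of a given exponent in the support is the same upstairs and
downstairs (trivial restatement recorded for the card's dictionary). [OURS · elementary] -/
theorem mem_support_lift_iff {σ O k : Type*} [CommSemiring O] [CommSemiring k] {g' : MvPolynomial σ O} {g : MvPolynomial σ k}
    (h : g'.support = g.support) (e : σ →₀ ℕ) : e ∈ g'.support ↔ e ∈ g.support := by
  rw [h]

/-- **Key letter, third strict transform.** In the composite chart `(X,Y,Z) = (x²yz², xyz, xyz²)` the key polynomial `q = X² + Y²Z` of S10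
becomes `x³y²z⁴ · (x + y)`: `St³ W_q = V(x + y) ⊇ σ∗ = {z = 0, x + y = 0}`. Holds over every commutative ring. [OURS · `ring`] -/
theorem keyLetter_chart3 {A : Type*} [CommRing A] (x y z : A) :
    (x ^ 2 * y * z ^ 2) ^ 2 + (x * y * z) ^ 2 * (x * y * z ^ 2) = x ^ 3 * y ^ 2 * z ^ 4 * (x + y) := by
  ring

/-- **Du Val key letter, third strict transform.** `M = V(X² + Y²Z + Z³)` (a `D₄` point at `x₀`, isolated): `St³ M = V(x + y + y z²) ⊇ σ∗`, smooth
along `σ∗`. [OURS · `ring`] -/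
theorem duValLetter_chart3 {A : Type*} [CommRing A] (x y z : A) :
    (x ^ 2 * y * z ^ 2) ^ 2 + (x * y * z) ^ 2 * (x * y * z ^ 2) + (x * y * z ^ 2) ^ 3 =
      x ^ 3 * y ^ 2 * z ^ 4 * ((x + y) + y * z ^ 2) := by
  ring

/-- **S10, third strict transform.** `f = (X² + Y²Z)² + X⁵ + Z⁶ + XY⁸ + X¹⁰ + Y¹⁰ + Z¹⁰` becomes `x⁶y⁴z⁸ · ((x + y)² + z² · R)`: the strict transform
lies in `(z, x + y)²`, i.e. `T₃` has multiplicity `2` along `σ∗` (R41″'s reading, now over every commutative ring). [OURS · `ring`] -/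
theorem S10_chart3 {A : Type*} [CommRing A] (x y z : A) :
    ((x ^ 2 * y * z ^ 2) ^ 2 + (x * y * z) ^ 2 * (x * y * z ^ 2)) ^ 2 + (x ^ 2 * y * z ^ 2) ^ 5 + (x * y * z ^ 2) ^ 6 +
        (x ^ 2 * y * z ^ 2) * (x * y * z) ^ 8 + (x ^ 2 * y * z ^ 2) ^ 10 + (x * y * z) ^ 10 + (x * y * z ^ 2) ^ 10 =
      x ^ 6 * y ^ 4 * z ^ 8 * ((x + y) ^ 2 +
        z ^ 2 * (x ^ 4 * y + y ^ 2 * z ^ 2 + x ^ 4 * y ^ 5 + x ^ 4 * y ^ 6 + x ^ 14 * y ^ 6 * z ^ 10 + x ^ 4 * y ^ 6 * z ^ 10)) := by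
  ring

/-- **Second strict transforms (chart `P:S.y · CAR:E1.x`, `(X,Y,Z) = (x²y, xy, xyz)`):** `St² W_q = V(x + yz)` (smooth, contains `φ_q = {x = z = 0}`)
and S10's `T₂ = (x + yz)² + x²·R₂` — the (S3) reading of RESIDUE-CUSTOMER-S10.md over every commutative ring. [OURS · `ring`] -/
theorem keyLetter_chart2 {A : Type*} [CommRing A] (x y z : A) :
    (x ^ 2 * y) ^ 2 + (x * y) ^ 2 * (x * y * z) = x ^ 3 * y ^ 2 * (x + y * z) := by
  ring


/-! ### The du Val key letter `M = V(X² + Y²Z + Z³)` — MODEL CERTIFICATE identities (ROUND 16, job j315451)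
Total transform = (exceptional equation)^{multiplicity} · (strict transform) in every chart of `P = Bl_{x₀}` and of the carrier round
`CAR = Bl_{L̃}` (`L̃ = S ∩ St H = {x = 0} ⊂ S`), with ALL coefficients equal to `1`: the identities hold over every commutative ring, hence
verbatim over the DVR `O` — the O-model `M_O := V(X² + Y²Z + Z³) ⊂ 𝔸³_O` has strict transforms with the SAME equations, so
`St² M_O` is covered by `V(x + yz + yz³)`, `V(x²y + z + z³)`, `V(x + y²z + z)`, `V(x²z + y² + 1)` (+ the chart `S.x` missed by `L̃`),
each smooth over `O` when `2` is invertible in the residue field (a partial derivative is `1`, or the computation in the card R16-3).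
[OURS · `ring` · counted 0] -/

/-- `P`, chart `S.y` : `(X,Y,Z) = (xy, y, zy)`; multiplicity 2 at `x₀`; `St¹M = V(x² + yz + yz³)` (three A₁ points on `L̃`). -/
theorem duVal_P_Sy {A : Type*} [CommRing A] (x y z : A) :
    (x * y) ^ 2 + y ^ 2 * (z * y) + (z * y) ^ 3 = y ^ 2 * (x ^ 2 + y * z + y * z ^ 3) := by
  ring

/-- `CAR` after `S.y`, chart `E1.x` : `y ↦ xy`; `St²M = V(x + yz + yz³)`, `∂/∂x = 1` ⇒ smooth over any base. -/
theorem duVal_CAR_Sy_E1x {A : Type*} [CommRing A] (x y z : A) :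
    x ^ 2 + (x * y) * z + (x * y) * z ^ 3 = x * (x + y * z + y * z ^ 3) := by
  ring

/-- `CAR` after `S.y`, chart `E1.y` : `x ↦ xy`; `St²M = V(x²y + z + z³)`, `∂/∂z = 1 + 3z²` (regular for residue characteristic `≠ 2`, card R16-3). -/
theorem duVal_CAR_Sy_E1y {A : Type*} [CommRing A] (x y z : A) :
    (x * y) ^ 2 + y * z + y * z ^ 3 = y * (x ^ 2 * y + z + z ^ 3) := by
  ring

/-- `P`, chart `S.z` : `(X,Y,Z) = (xz, yz, z)`; `St¹M = V(x² + y²z + z)`. -/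
theorem duVal_P_Sz {A : Type*} [CommRing A] (x y z : A) :
    (x * z) ^ 2 + (y * z) ^ 2 * z + z ^ 3 = z ^ 2 * (x ^ 2 + y ^ 2 * z + z) := by
  ring

/-- `CAR` after `S.z` (centre `L̃ = (x, z)`), chart `E1.x` : `z ↦ xz`; `St²M = V(x + y²z + z)`, `∂/∂x = 1`. -/
theorem duVal_CAR_Sz_E1x {A : Type*} [CommRing A] (x y z : A) :
    x ^ 2 + y ^ 2 * (x * z) + x * z = x * (x + y ^ 2 * z + z) := by
  ring

/-- `CAR` after `S.z`, chart `E1.z` : `x ↦ xz`; `St²M = V(x²z + y² + 1)` (no point with `x = y = 0` ⇒ regular over any base). -/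
theorem duVal_CAR_Sz_E1z {A : Type*} [CommRing A] (x y z : A) :
    (x * z) ^ 2 + y ^ 2 * z + z = z * (x ^ 2 * z + y ^ 2 + 1) := by
  ring

/-- `P`, chart `S.x` : `(X,Y,Z) = (x, yx, zx)`; `St¹M = V(1 + xy²z + xz³)` misses `S ∩ D₊(x) ⊉ L̃` — the carrier round does not touch this chart. -/
theorem duVal_P_Sx {A : Type*} [CommRing A] (x y z : A) :
    x ^ 2 + (y * x) ^ 2 * (z * x) + (z * x) ^ 3 = x ^ 2 * (1 + x * y ^ 2 * z + x * z ^ 3) := by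
  ring

/-- The verbatim lift of the du Val key letter: over ANY commutative ring the polynomial `X² + Y²Z + Z³` is the image of the
"same" polynomial under `MvPolynomial.map π` — no choice involved (special case of `exists_lift_support_eq` with all coefficients `1`). -/
theorem duVal_map {O k : Type*} [CommSemiring O] [CommSemiring k] (π : O →+* k) :
    MvPolynomial.map π ((MvPolynomial.X 0) ^ 2 + (MvPolynomial.X 1) ^ 2 * MvPolynomial.X 2 + (MvPolynomial.X 2) ^ 3 :
      MvPolynomial (Fin 3) O) =
    (MvPolynomial.X 0) ^ 2 + (MvPolynomial.X 1) ^ 2 * MvPolynomial.X 2 + (MvPolynomial.X 2) ^ 3 := by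
  simp [map_add, map_mul, map_pow, MvPolynomial.map_X]

end Summit.ResolutionOfSingularities.ResolutionOfSingularities.Cruxes.EquisingularLiftNatThree.ToricTowers.R16
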